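import Summits.HodgeConjecture.CorCM.HypLiu418.A3Liu418EtaleItems
import Literature.NumberTheory.Automorphic.Liu2021.AppendixC.Prop413DataOfRestOne
import Literature.NumberTheory.Automorphic.Liu2021.Def411AsPrinted
import Literature.RepresentationTheory.Semisimple.IsotypicCutOut
import HarnessLib

/-!
# [Liu 2021, Thm 4.18] — the MAIN ISOMORPHISM at a one-object rest from the ℓ-adic items of its printed proof («isotypic cut-out»; G1 of stub G
# `stub_mainGaloisGlue` of `Lines/a3-liu418.lean` v3 1b96ade3f8b6b529)

Cell `hodgecm-mathlib` (D-0151), fan A, rung A-III; Summits lane `CorCM/HypLiu418/`; namespace `Summit.HodgeConjecture.CorCM.Lines.A3Liu418` (the line's).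
Seat prover-hodgecm-mathlib-A-p19 (KEY `a3-main-galois-glue`), 2026-08-28.  ONE THEOREM, generic over a §4.2 datum `C : Sec42Data P5 isotropicAt`
(`n ≥ 3`), μ-uniform oscillator carriers `U : UniformOmega C`, Albanese Hecke translates `T : C.HeckeTranslates`, a conjugate-symplectic weight-one `μ` with a
[Def 4.5] presentation `(φ, ι, Car)` and ONE object `obj ∈ 𝒜(μ)`, and one `(ℓ, ι_ℓ)` with a Hecke datum `X` on `H¹_ét(A_∞)`; its hypotheses are the ℓ-adic ITEM
PREDICATES of the skeleton (tree declarations of ✔ `A3Liu418EtaleItems.lean`, A-p06 p598646 = §EtaleItems byte-for-byte): `EtaleThetaDecomposition` ([Prop 4.13]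
through the comparison), `FaltingsIsotypic` (Faltings + the CM line), `Thm415Pinned` at `(μ, A_μ, i_μ)` ([Thm 4.15], B-typ04), `GaloisLabelSeparation`, and
[Def 4.11]'s irreducible-or-zero for every summand of `U`; its conclusion is the printed MAIN ISOMORPHISM `Ω(μ) ⊗_{M_μ} ℂ ≃ ⊕_{(ε,χ) adm} ω(μ,ε,χ)` of
`ℂ[𝔾(𝔸_F^∞)]`-modules (a `ℂ`-linear `𝔾`-equivariant `LinearEquiv`, the first conjunct of `MainGalois`) for the datum
`toThm418Data C (U.rest (restTailOne φ ι hμ hw Car (T.rhoΩOne …)))`.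

Print (Y. Liu, *Fourier–Jacobi cycles and arithmetic relative trace formula*, Camb. J. Math. 9 (2021) = arXiv:2102.11518, `FJcycle.tex` l. 2245–2268): «Take an
embedding `τ'` in `Φ_μ` … the maximal subspace of `H¹_{B,τ'}(A_μ, ℂ)` over which `M_μ` acts via the inclusion `M_μ ↪ ℂ` has dimension `1`. We choose a basis
`α` … we obtain a map `Ω(μ) → H¹_{B,τ'}(A_∞, ℂ)` by pulling back `α` … By Faltings' isogeny theorem, `Ω(μ) ⊗_{M_μ,ι_ℓ} ℚ_ℓ^{ac} ≃ Hom_{Gal}(ℚ_ℓ^{ac}·α,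
H¹_ét(A_μ …))`. … by Proposition 4.13 … and Theorem 4.15 …, we have an isomorphism `Hom_{Gal}(ℚ_ℓ^{ac}·α, H¹_ét(…)) ≃ ⊕_ε ⊕_χ ω(μ,ε,χ) ⊗_{ℂ,ι_ℓ} ℚ_ℓ^{ac}` of
`ℚ_ℓ^{ac}[𝔾(𝔸_F^∞)]`-modules induced by pulling back `α` … Thus, we obtain an isomorphism as in the theorem.»

ROUTE («isotypic cut-out», semisimple-module bookkeeping): `Ψ(−)(α)` embeds `ℂ ⊗_{M_μ} Ω(μ)` `ι_ℓ`-semilinearly and `𝔾`-equivariantly into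
`E := ℚ_ℓ^{ac} ⊗ H¹_ét(A_∞)`, onto the subspace `N` on which `Γ_E` acts through the eigencharacter of the line `ℚ_ℓ^{ac}·α` (from `FaltingsIsotypic`, the line being
a line); `E ≅ ⊕_t ι_ℓ∘ω_t` over ALL labelled admissible triples (`BettiComparison` + `BettiThetaDecomposition`); the summands with label `μ` lie in `N`
(`Thm415Pinned`), those with label `≠ μ` admit no non-zero intertwiner into `N` (`GaloisLabelSeparation`), and all are irreducible or zero ⇒ `E`, hence `N`, is a
semisimple `𝔾`-module and `N = ⊕_{t : t.μ = μ} ι_ℓ∘ω_t` — ✔ `Representation.exists_equiv_directSum_subtype_of_range_eq` (`IsotypicCutOut.lean`, p599048; the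
`ℂ`-structure on `E` is read through `ι_ℓ` by `Module.compHom`, so `ι_ℓ`-semilinear = `ℂ`-linear); finally `{t // t.μ = μ}` IS the admissible index set at `μ` on
the nose (identity on `(ε, χ)`).  Item (2) of Thm 4.18 is NOT used.  ORIENTATION: none chosen (the label and the datum are the consumer's).  HC_CM is proved
only modulo the 7 printed citations (`hDel`, `h21`, `hLiu418`, `h411`, `h413`, `hD3`, `hD1''`) until rung 0 closes; nothing of [Liu2021] is asserted here — every
ℓ-adic item is a HYPOTHESIS of the theorem.

References: [Liu2021] Thm 4.18 proof (FJcycle.tex l. 2245–2268); Prop. 4.13 (l. 2110–2131); Thm 4.15 (l. 2177–2182); Def. 4.11; Def. 4.12; Def. 4.5 (2);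
[Faltings1983] Satz 4; [Lang2002] XVII §2 (semisimplicity).
-/

set_option autoImplicit false

noncomputable section

namespace Summit.HodgeConjecture.CorCM.Lines.A3Liu418

open scoped TensorProduct DirectSum
open NumberField
open Literature.NumberTheory.Automorphic
open Literature.NumberTheory.Automorphic.Liu2021 Literature.NumberTheory.Automorphic.Liu2021.AppendixC
open Literature.NumberTheory.Automorphic.Liu2021.AppendixC.RestOne
open Literature.AlgebraicGeometry.Liu2021 (IsAdmissibleElement)

section MainIso

variable {F₀ E₀ : Type} [Field F₀] [NumberField F₀] [IsTotallyReal F₀] [Field E₀] [NumberField E₀] [Algebra F₀ E₀]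
  [IsTotallyComplex E₀] [Algebra.IsQuadraticExtension F₀ E₀] [IsCMField E₀]
variable {P5 : PropC5Data F₀ E₀} {isotropicAt : ℕ → Prop} {C : Sec42Data P5 isotropicAt}
variable {L₀ : Type} [Field L₀] [NumberField L₀] [IsGalois ℚ L₀]

set_option maxHeartbeats 1600000 in
/-- **The main isomorphism of [Liu2021, Thm 4.18] at a one-object rest, from the ℓ-adic items of its printed proof (l. 2245–2268).**
For a §4.2 datum `C` (`n ≥ 3`), μ-uniform oscillator carriers `U` whose summands are irreducible or zero ([Def 4.11]), Albanese Hecke translates `T`,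
a conjugate-symplectic weight-one `μ` with a CM datum presented by `(φ, ι, Car)` and ONE object `obj ∈ 𝒜(μ)` (Prop 4.6 (1)), and, at one `(ℓ, ι_ℓ)`,
a Hecke datum `X` on `H¹_ét(A_∞)` carrying the Betti theta decomposition [Prop 4.13] (`EtaleThetaDecomposition`), the Faltings identification
(`FaltingsIsotypic`), [Thm 4.15] pinned at `(μ, A_μ, i_μ)` (`Thm415Pinned`) and the Galois separation of labels (`GaloisLabelSeparation`): there is a
`ℂ`-linear `𝔾(𝔸_F^∞)`-equivariant isomorphism `Ω(μ) ⊗_{M_μ} ℂ ≃ ⊕_{(ε,χ) adm} ω(μ,ε,χ)` for the datum `toThm418Data C (U.rest (restTailOne φ ι hμ hw Car (T.rhoΩOne …)))`.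
Route («isotypic cut-out»): `Ψ(−)(α)` embeds `ℂ ⊗ Ω(μ)` `ι_ℓ`-semilinearly and equivariantly into `E := ℚ_ℓ^{ac} ⊗ H¹_ét(A_∞)`, onto the subspace
`N` on which `Γ_E` acts through the eigencharacter of the line `ℚ_ℓ^{ac}·α`; `E ≅ ⊕_t ω_t ⊗_{ι_ℓ} ℚ_ℓ^{ac}` over ALL labelled admissible triples
(comparison + [Prop 4.13]); the summands with label `μ` lie in `N` ([Thm 4.15]), those with label `≠ μ` admit no non-zero intertwiner into `N`
(separation), all are irreducible or zero ⇒ `N = ⊕_{t : t.μ = μ} ω_t ⊗ ℚ_ℓ^{ac}` (✔ `Representation.exists_equiv_directSum_subtype_of_range_eq`, scalars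
read through `ι_ℓ⁻¹`), and `{t // t.μ = μ}` is the admissible index set at `μ` on the nose.  Item (2) is NOT used.
[cite: Liu2021, Thm 4.18 proof (FJcycle.tex l. 2245–2268); Prop. 4.13; Thm 4.15; Def. 4.11; Def. 4.12] -/
theorem exists_mainIso_of_etaleItems (U : UniformOmega C) (T : C.HeckeTranslates) (φ : E₀ →ₐ[ℚ] L₀) (ι : L₀ →+* ℂ)
    {μ : Literature.NumberTheory.Automorphic.IdeleClassGroup E₀ →ₜ* Circle} (hμ : IdeleClassGroup.IsConjugateSymplectic E₀ μ)
    (hw : IdeleClassGroup.HasWeight E₀ μ 1) (Car : Def45.Carriers E₀ μ) (ℓ : ℕ) [Fact ℓ.Prime] (X : C.EtaleHeckeDatum ℓ)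
    (ι' : ℂ ≃+* AlgebraicClosure ℚ_[ℓ]) (hn : 3 ≤ C.n)
    (hirr : ∀ t : AdmTripleAll U, IsIrreducibleOrZero (U.rho t.μ t.hμ t.ε t.χ))
    (obj : RestOne.ObjOne φ ι hμ hw Car)
    (hB : EtaleThetaDecomposition U ℓ X ι') (hF : FaltingsIsotypic T φ ι hμ hw Car ℓ X ι')
    (h415 : Thm415Pinned C U ℓ X ι' μ hμ (RestOne.AμOne φ ι hμ hw Car obj) (RestOne.iOne φ ι hμ hw Car obj))
    (hS : GaloisLabelSeparation U φ ι hμ hw Car ℓ X ι') :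
    ∃ Φ : (ℂ ⊗[fieldOfValues E₀ μ] RestOne.ΩOne C φ ι hμ hw Car) ≃ₗ[ℂ]
        ⨁ i : (toThm418Data C (U.rest (restTailOne φ ι hμ hw Car (T.rhoΩOne φ ι hμ hw Car)))).AdmIndex,
          (toThm418Data C (U.rest (restTailOne φ ι hμ hw Car (T.rhoΩOne φ ι hμ hw Car)))).omegaAt i,
      ∀ (g : C.G) (x : ℂ ⊗[fieldOfValues E₀ μ] RestOne.ΩOne C φ ι hμ hw Car)
        (i : (toThm418Data C (U.rest (restTailOne φ ι hμ hw Car (T.rhoΩOne φ ι hμ hw Car)))).AdmIndex),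
        Φ ((T.rhoΩOne φ ι hμ hw Car g).baseChange ℂ x) i =
          (toThm418Data C (U.rest (restTailOne φ ι hμ hw Car (T.rhoΩOne φ ι hμ hw Car)))).rhoAt i g (Φ x i) := by
  classical
  -- the Betti theta decomposition with its comparison, and the Faltings identification at `obj`
  obtain ⟨H, _, _, rhoB, ⟨cmp⟩, ΨB, hΨB⟩ := hB
  obtain ⟨hrank, Ψ, hΨinj, hΨrange, hΨG⟩ := hF obj
  -- scalars on `E := ℚ_ℓ^{ac} ⊗ H¹_ét(A_∞)` read through `ι_ℓ`
  letI modC : Module ℂ (AlgebraicClosure ℚ_[ℓ] ⊗[ℚ_[ℓ]] C.etaleH1Tower ℓ) :=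
    Module.compHom (AlgebraicClosure ℚ_[ℓ] ⊗[ℚ_[ℓ]] C.etaleH1Tower ℓ) (ι' : ℂ →+* AlgebraicClosure ℚ_[ℓ])
  have smul_def : ∀ (c : ℂ) (e : AlgebraicClosure ℚ_[ℓ] ⊗[ℚ_[ℓ]] C.etaleH1Tower ℓ),
      c • e = (ι' : ℂ →+* AlgebraicClosure ℚ_[ℓ]) c • e := fun _ _ => rfl
  -- the Hecke action on `E` as a `ℂ`-linear representation
  let ρE : Representation ℂ C.G (AlgebraicClosure ℚ_[ℓ] ⊗[ℚ_[ℓ]] C.etaleH1Tower ℓ) :=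
    { toFun := fun g =>
        { toFun := fun e => (X.rhoEt g).baseChange (AlgebraicClosure ℚ_[ℓ]) e
          map_add' := fun x y => map_add _ x y
          map_smul' := fun c e => by
            change (X.rhoEt g).baseChange (AlgebraicClosure ℚ_[ℓ]) ((ι' : ℂ →+* AlgebraicClosure ℚ_[ℓ]) c • e) =
              (ι' : ℂ →+* AlgebraicClosure ℚ_[ℓ]) c • (X.rhoEt g).baseChange (AlgebraicClosure ℚ_[ℓ]) e
            exact map_smul _ _ _ }
      map_one' := by
        apply LinearMap.ext
        intro e
        change ((X.rhoEt 1).baseChange (AlgebraicClosure ℚ_[ℓ])) e = e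
        rw [map_one, LinearMap.baseChange_one]
        rfl
      map_mul' := fun g h => by
        apply LinearMap.ext
        intro e
        change ((X.rhoEt (g * h)).baseChange (AlgebraicClosure ℚ_[ℓ])) e =
          ((X.rhoEt g).baseChange (AlgebraicClosure ℚ_[ℓ])) (((X.rhoEt h).baseChange (AlgebraicClosure ℚ_[ℓ])) e)
        rw [map_mul, Module.End.mul_eq_comp, LinearMap.baseChange_comp]
        rfl }
  have hρE : ∀ (g : C.G) (e : AlgebraicClosure ℚ_[ℓ] ⊗[ℚ_[ℓ]] C.etaleH1Tower ℓ),
      ρE g e = (X.rhoEt g).baseChange (AlgebraicClosure ℚ_[ℓ]) e := fun _ _ => rfl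
  -- Hecke and Galois commute on `E` (base change of `X.comm`)
  have hcommE : ∀ (g : C.G) (σ : Field.absoluteGaloisGroup E₀) (e : AlgebraicClosure ℚ_[ℓ] ⊗[ℚ_[ℓ]] C.etaleH1Tower ℓ),
      (X.rhoEt g).baseChange (AlgebraicClosure ℚ_[ℓ]) ((C.towerRep ℓ σ).baseChange (AlgebraicClosure ℚ_[ℓ]) e) =
        (C.towerRep ℓ σ).baseChange (AlgebraicClosure ℚ_[ℓ]) ((X.rhoEt g).baseChange (AlgebraicClosure ℚ_[ℓ]) e) := by
    intro g σ e
    have hc : X.rhoEt g ∘ₗ C.towerRep ℓ σ = C.towerRep ℓ σ ∘ₗ X.rhoEt g := LinearMap.ext (X.comm g σ)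
    have hbc := congrArg (LinearMap.baseChange (AlgebraicClosure ℚ_[ℓ])) hc
    rw [LinearMap.baseChange_comp, LinearMap.baseChange_comp] at hbc
    exact LinearMap.congr_fun hbc e
  -- the line `ℚ_ℓ^{ac}·α`: a generator `y₀` and the eigencharacter bookkeeping
  obtain ⟨y₀, hy₀0, hy₀span⟩ := finrank_eq_one_iff'.1 hrank
  have hy₀0' : (y₀ : AlgebraicClosure ℚ_[ℓ] ⊗[ℚ_[ℓ]] Module.Dual ℚ_[ℓ] ((RestOne.AμOne φ ι hμ hw Car obj).rationalTateModule ℓ)) ≠ 0 :=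
    fun h => hy₀0 (Subtype.ext h)
  -- «σ acts by c on some non-zero vector of the line» ⇒ «σ acts by c on the whole line»
  have hline : ∀ (σ : Field.absoluteGaloisGroup E₀) (c : AlgebraicClosure ℚ_[ℓ]),
      (∃ x ∈ cmEigenline ℓ (RestOne.AμOne φ ι hμ hw Car obj) (IdeleClassGroup.muAlgValueField E₀ μ) (RestOne.iOne φ ι hμ hw Car obj) ι',
          x ≠ 0 ∧ galoisH1Bar ℓ (RestOne.AμOne φ ι hμ hw Car obj) σ x = c • x) →
        ∀ x ∈ cmEigenline ℓ (RestOne.AμOne φ ι hμ hw Car obj) (IdeleClassGroup.muAlgValueField E₀ μ) (RestOne.iOne φ ι hμ hw Car obj) ι',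
          galoisH1Bar ℓ (RestOne.AμOne φ ι hμ hw Car obj) σ x = c • x := by
    rintro σ c ⟨x₁, hx₁, hx₁0, hσx₁⟩ x hx
    have h1 := (finrank_eq_one_iff_of_nonzero' (⟨x₁, hx₁⟩ : cmEigenline ℓ (RestOne.AμOne φ ι hμ hw Car obj)
      (IdeleClassGroup.muAlgValueField E₀ μ) (RestOne.iOne φ ι hμ hw Car obj) ι') (fun h => hx₁0 (congrArg Subtype.val h))).1 hrank ⟨x, hx⟩
    obtain ⟨a, ha⟩ := h1
    have ha' : a • x₁ = x := congrArg Subtype.val ha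
    rw [← ha', map_smul, hσx₁, smul_comm]
  -- the cut-out subspace `N`: «Γ_E acts through the eigencharacter of the line»
  let N₀ : Submodule (AlgebraicClosure ℚ_[ℓ]) (AlgebraicClosure ℚ_[ℓ] ⊗[ℚ_[ℓ]] C.etaleH1Tower ℓ) :=
    { carrier := {e | ∀ (σ : Field.absoluteGaloisGroup E₀) (c : AlgebraicClosure ℚ_[ℓ]),
        (∀ x ∈ cmEigenline ℓ (RestOne.AμOne φ ι hμ hw Car obj) (IdeleClassGroup.muAlgValueField E₀ μ) (RestOne.iOne φ ι hμ hw Car obj) ι',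
            galoisH1Bar ℓ (RestOne.AμOne φ ι hμ hw Car obj) σ x = c • x) →
          (C.towerRep ℓ σ).baseChange (AlgebraicClosure ℚ_[ℓ]) e = c • e}
      zero_mem' := fun σ c _ => by simp only [map_zero, smul_zero]
      add_mem' := fun {x y} hx hy σ c hP => by rw [map_add, hx σ c hP, hy σ c hP, smul_add]
      smul_mem' := fun a x hx σ c hP => by rw [map_smul, hx σ c hP, smul_comm] }
  have hN₀ : ∀ e, e ∈ N₀ ↔ ∀ (σ : Field.absoluteGaloisGroup E₀) (c : AlgebraicClosure ℚ_[ℓ]),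
      (∀ x ∈ cmEigenline ℓ (RestOne.AμOne φ ι hμ hw Car obj) (IdeleClassGroup.muAlgValueField E₀ μ) (RestOne.iOne φ ι hμ hw Car obj) ι',
          galoisH1Bar ℓ (RestOne.AμOne φ ι hμ hw Car obj) σ x = c • x) →
        (C.towerRep ℓ σ).baseChange (AlgebraicClosure ℚ_[ℓ]) e = c • e := fun _ => Iff.rfl
  let Nℂ : Submodule ℂ (AlgebraicClosure ℚ_[ℓ] ⊗[ℚ_[ℓ]] C.etaleH1Tower ℓ) :=
    { carrier := N₀
      zero_mem' := N₀.zero_mem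
      add_mem' := fun hx hy => N₀.add_mem hx hy
      smul_mem' := fun c e he => by
        change (ι' : ℂ →+* AlgebraicClosure ℚ_[ℓ]) c • e ∈ N₀
        exact N₀.smul_mem _ he }
  let N : Subrepresentation ρE :=
    ⟨Nℂ, fun g e he => by
      change e ∈ N₀ at he
      change ρE g e ∈ N₀
      intro σ c hP
      rw [hρE, ← hcommE, he σ c hP, map_smul]⟩
  have hN : ∀ e, e ∈ N ↔ e ∈ N₀ := fun _ => Iff.rfl
  -- the comparison `cmp : H ≃ E`, `ℂ`-linearly (scalars through `ι_ℓ`), and the transported theta decomposition `ΦE : E ≃ ⊕_t ω_t`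
  let cmpL : H →ₗ[ℂ] AlgebraicClosure ℚ_[ℓ] ⊗[ℚ_[ℓ]] C.etaleH1Tower ℓ :=
    { toFun := fun h => cmp.cmp h
      map_add' := fun x y => map_add _ x y
      map_smul' := fun c h => by rw [LinearMap.map_smulₛₗ]; rfl }
  let cmpE : H ≃ₗ[ℂ] AlgebraicClosure ℚ_[ℓ] ⊗[ℚ_[ℓ]] C.etaleH1Tower ℓ := LinearEquiv.ofBijective cmpL cmp.bijective
  have hcmpE : ∀ h, cmpE h = cmp.cmp h := fun _ => rfl
  have hcmpE_symm : ∀ (g : C.G) (e : AlgebraicClosure ℚ_[ℓ] ⊗[ℚ_[ℓ]] C.etaleH1Tower ℓ),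
      cmpE.symm (ρE g e) = rhoB g (cmpE.symm e) := by
    intro g e
    apply cmpE.injective
    rw [LinearEquiv.apply_symm_apply, hcmpE, cmp.comm, ← hcmpE, LinearEquiv.apply_symm_apply]
    exact hρE g e
  let ΦE : (AlgebraicClosure ℚ_[ℓ] ⊗[ℚ_[ℓ]] C.etaleH1Tower ℓ) ≃ₗ[ℂ] ⨁ t : AdmTripleAll U, U.omega t.μ t.hμ t.ε t.χ := cmpE.symm.trans ΨB
  have hΦE : ∀ (g : C.G) (e : AlgebraicClosure ℚ_[ℓ] ⊗[ℚ_[ℓ]] C.etaleH1Tower ℓ) (t : AdmTripleAll U),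
      ΦE (ρE g e) t = U.rho t.μ t.hμ t.ε t.χ g (ΦE e t) := by
    intro g e t
    change ΨB (cmpE.symm (ρE g e)) t = U.rho t.μ t.hμ t.ε t.χ g (ΨB (cmpE.symm e) t)
    rw [hcmpE_symm, hΨB]
  have hΦE_symm : ∀ (t : AdmTripleAll U) (w : U.omega t.μ t.hμ t.ε t.χ),
      ΦE.symm (DirectSum.lof ℂ (AdmTripleAll U) (fun t => U.omega t.μ t.hμ t.ε t.χ) t w) =
        cmp.cmp (ΨB.symm (DirectSum.lof ℂ (AdmTripleAll U) (fun t => U.omega t.μ t.hμ t.ε t.χ) t w)) := fun _ _ => rfl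
  -- `ΨB⁻¹ ∘ ι_t` intertwines
  have hΨB_symm : ∀ (t : AdmTripleAll U) (g : C.G) (w : U.omega t.μ t.hμ t.ε t.χ),
      ΨB.symm (DirectSum.lof ℂ (AdmTripleAll U) (fun t => U.omega t.μ t.hμ t.ε t.χ) t (U.rho t.μ t.hμ t.ε t.χ g w)) =
        rhoB g (ΨB.symm (DirectSum.lof ℂ (AdmTripleAll U) (fun t => U.omega t.μ t.hμ t.ε t.χ) t w)) := by
    intro t g w
    apply ΨB.injective
    apply DirectSum.ext
    intro s
    rw [LinearEquiv.apply_symm_apply, hΨB, LinearEquiv.apply_symm_apply, DirectSum.lof_eq_of, DirectSum.lof_eq_of]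
    by_cases h : t = s
    · subst h
      rw [DirectSum.of_eq_same, DirectSum.of_eq_same]
    · rw [DirectSum.of_eq_of_ne _ _ _ (Ne.symm h), DirectSum.of_eq_of_ne _ _ _ (Ne.symm h), map_zero]
  -- the structural intertwiners `f_t : ω_t → E`, `ι_ℓ`-semilinear, in the Hom-space of [Thm 4.15]
  have hft : ∀ t : AdmTripleAll U, ∃ f : U.omega t.μ t.hμ t.ε t.χ →ₛₗ[(ι' : ℂ →+* AlgebraicClosure ℚ_[ℓ])]
        AlgebraicClosure ℚ_[ℓ] ⊗[ℚ_[ℓ]] C.etaleH1Tower ℓ,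
      f ∈ X.omegaHom ι' (U.rho t.μ t.hμ t.ε t.χ) ∧
        ∀ w, f w = ΦE.symm (DirectSum.lof ℂ (AdmTripleAll U) (fun t => U.omega t.μ t.hμ t.ε t.χ) t w) := by
    intro t
    refine ⟨cmp.cmp.comp (ΨB.symm.toLinearMap ∘ₗ DirectSum.lof ℂ (AdmTripleAll U) (fun t => U.omega t.μ t.hμ t.ε t.χ) t), ?_, fun w => rfl⟩
    intro g w
    change cmp.cmp (ΨB.symm (DirectSum.lof ℂ (AdmTripleAll U) (fun t => U.omega t.μ t.hμ t.ε t.χ) t (U.rho t.μ t.hμ t.ε t.χ g w))) =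
      (X.rhoEt g).baseChange (AlgebraicClosure ℚ_[ℓ]) (cmp.cmp (ΨB.symm (DirectSum.lof ℂ (AdmTripleAll U) (fun t => U.omega t.μ t.hμ t.ε t.χ) t w)))
    rw [hΨB_symm, cmp.comm]
  -- (H2) the summands with label `μ` lie in `N` — [Thm 4.15] pinned at `(μ, A_μ, i_μ)`
  have H2 : ∀ t : AdmTripleAll U, t.μ = μ → ∀ w : U.omega t.μ t.hμ t.ε t.χ,
      ΦE.symm (DirectSum.lof ℂ (AdmTripleAll U) (fun t => U.omega t.μ t.hμ t.ε t.χ) t w) ∈ N := by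
    intro t ht w
    obtain ⟨f, hf, hfw⟩ := hft t
    rw [hN, hN₀, ← hfw]
    intro σ c hP
    obtain ⟨μ', hμ', hw', ε, adm, χ⟩ := t
    change μ' = μ at ht
    subst ht
    exact Thm415Pinned.apply h415 hn hw ε adm χ σ c ⟨y₀, y₀.2, hy₀0', hP _ y₀.2⟩ hf w
  -- (H1) the summands with label `≠ μ` admit no non-zero intertwiner into `N` — the separation of labels
  have H1 : ∀ t : AdmTripleAll U, ¬ t.μ = μ →
      ∀ f : U.omega t.μ t.hμ t.ε t.χ →ₗ[ℂ] AlgebraicClosure ℚ_[ℓ] ⊗[ℚ_[ℓ]] C.etaleH1Tower ℓ,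
        (∀ (g : C.G) (w : U.omega t.μ t.hμ t.ε t.χ), f (U.rho t.μ t.hμ t.ε t.χ g w) = ρE g (f w)) → (∀ w, f w ∈ N) → f = 0 := by
    intro t ht f hfG hfN
    by_contra hf0
    -- `f` as an `ι_ℓ`-semilinear intertwiner
    let fₛ : U.omega t.μ t.hμ t.ε t.χ →ₛₗ[(ι' : ℂ →+* AlgebraicClosure ℚ_[ℓ])] AlgebraicClosure ℚ_[ℓ] ⊗[ℚ_[ℓ]] C.etaleH1Tower ℓ :=
      { toFun := fun w => f w
        map_add' := fun x y => map_add f x y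
        map_smul' := fun c w => by rw [map_smul]; rfl }
    have hfₛ : fₛ ∈ X.omegaHom ι' (U.rho t.μ t.hμ t.ε t.χ) := fun g w => hfG g w
    have hfₛ0 : fₛ ≠ 0 := by
      intro h0
      apply hf0
      apply LinearMap.ext
      intro w
      exact LinearMap.congr_fun h0 w
    obtain ⟨σ, c, hxc, w, hw⟩ := hS obj t ht fₛ hfₛ hfₛ0
    exact hw (((hN _).1 (hfN w)) σ c (hline σ c hxc))
  -- `Ω(μ) ⊗ ℂ` with its `𝔾`-action, and `Ψ' := Ψ(−)(α) : Ω(μ) ⊗ ℂ → E`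
  let ρM : Representation ℂ C.G (ℂ ⊗[fieldOfValues E₀ μ] RestOne.ΩOne C φ ι hμ hw Car) :=
    { toFun := fun g => (T.rhoΩOne φ ι hμ hw Car g).baseChange ℂ
      map_one' := by rw [map_one, LinearMap.baseChange_one]
      map_mul' := fun g h => by rw [map_mul, Module.End.mul_eq_comp, LinearMap.baseChange_comp]; rfl }
  have hρM : ∀ g, ρM g = (T.rhoΩOne φ ι hμ hw Car g).baseChange ℂ := fun _ => rfl
  let Ψ' : (ℂ ⊗[fieldOfValues E₀ μ] RestOne.ΩOne C φ ι hμ hw Car) →ₗ[ℂ] AlgebraicClosure ℚ_[ℓ] ⊗[ℚ_[ℓ]] C.etaleH1Tower ℓ :=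
    { toFun := fun x => Ψ x y₀
      map_add' := fun x y => by rw [map_add, LinearMap.add_apply]
      map_smul' := fun c x => by rw [LinearMap.map_smulₛₗ, LinearMap.smul_apply]; rfl }
  have hΨ' : ∀ x, Ψ' x = Ψ x y₀ := fun _ => rfl
  have hΨ'inj : Function.Injective Ψ' := by
    rw [injective_iff_map_eq_zero]
    intro x hx
    rw [hΨ'] at hx
    apply hΨinj
    rw [map_zero]
    apply LinearMap.ext
    intro y
    obtain ⟨a, rfl⟩ := hy₀span y
    rw [map_smul, hx, smul_zero, LinearMap.zero_apply]
  have hΨ'G : ∀ (g : C.G) (x : ℂ ⊗[fieldOfValues E₀ μ] RestOne.ΩOne C φ ι hμ hw Car), Ψ' (ρM g x) = ρE g (Ψ' x) := by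
    intro g x
    rw [hΨ', hρM, hΨG, hρE, hΨ']
  have hΨ'N : ∀ e, e ∈ N ↔ e ∈ Set.range Ψ' := by
    intro e
    rw [hN, hN₀]
    constructor
    · intro he
      -- the homomorphism `ℚ_ℓ^{ac}·α → E`, `α ↦ e`, lies in the range of `Ψ`
      let b := FiniteDimensional.basisSingleton Unit hrank y₀ hy₀0
      let h : (cmEigenline ℓ (RestOne.AμOne φ ι hμ hw Car obj) (IdeleClassGroup.muAlgValueField E₀ μ) (RestOne.iOne φ ι hμ hw Car obj) ι') →ₗ[AlgebraicClosure ℚ_[ℓ]]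
          AlgebraicClosure ℚ_[ℓ] ⊗[ℚ_[ℓ]] C.etaleH1Tower ℓ := b.constr (AlgebraicClosure ℚ_[ℓ]) fun _ => e
      have hhy₀ : h y₀ = e := by
        have := b.constr_basis (AlgebraicClosure ℚ_[ℓ]) (fun _ => e) default
        rwa [FiniteDimensional.basisSingleton_apply] at this
      have hmem : h ∈ Set.range Ψ := by
        rw [hΨrange]
        intro σ c hP y
        obtain ⟨a, rfl⟩ := hy₀span y
        rw [map_smul, hhy₀, map_smul, he σ c hP, smul_comm]
      obtain ⟨x, hx⟩ := hmem
      exact ⟨x, by rw [hΨ', hx, hhy₀]⟩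
    · rintro ⟨x, rfl⟩ σ c hP
      rw [hΨ']
      obtain ⟨h', hh'⟩ : Ψ x ∈ Set.range Ψ := ⟨x, rfl⟩
      have key : Ψ x ∈ {h | ∀ (σ : Field.absoluteGaloisGroup E₀) (c : AlgebraicClosure ℚ_[ℓ]),
          (∀ x ∈ cmEigenline ℓ (RestOne.AμOne φ ι hμ hw Car obj) (IdeleClassGroup.muAlgValueField E₀ μ) (RestOne.iOne φ ι hμ hw Car obj) ι',
              galoisH1Bar ℓ (RestOne.AμOne φ ι hμ hw Car obj) σ x = c • x) →
            ∀ y, (C.towerRep ℓ σ).baseChange (AlgebraicClosure ℚ_[ℓ]) (h y) = c • h y} := by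
        rw [← hΨrange]; exact ⟨x, rfl⟩
      exact key σ c hP y₀
  -- the isotypic cut-out
  obtain ⟨Θ, hΘ, hΘG⟩ := Representation.exists_equiv_directSum_subtype_of_range_eq (k := ℂ) ρE
    (fun t : AdmTripleAll U => U.rho t.μ t.hμ t.ε t.χ) (fun t => hirr t) ΦE hΦE N (fun t => t.μ = μ) H1 H2 ρM Ψ' hΨ'inj hΨ'G hΨ'N
  -- re-index `{t // t.μ = μ}` by the admissible indices at `μ` (identity on `(ε, χ)`; summands agree on the nose)
  let e : {t : AdmTripleAll U // t.μ = μ} ≃ (toThm418Data C (U.rest (restTailOne φ ι hμ hw Car (T.rhoΩOne φ ι hμ hw Car)))).AdmIndex :=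
    { toFun := fun t => ⟨(t.1.ε, t.1.χ), by
        obtain ⟨⟨μ', hμ', hw', ε, adm, χ⟩, ht⟩ := t
        change μ' = μ at ht
        subst ht
        exact adm⟩
      invFun := fun i => ⟨⟨μ, hμ, hw, i.1.1, i.2, i.1.2⟩, rfl⟩
      left_inv := fun t => by
        obtain ⟨⟨μ', hμ', hw', ε, adm, χ⟩, ht⟩ := t
        change μ' = μ at ht
        subst ht
        rfl
      right_inv := fun i => rfl }
  have key : ∀ (y : ⨁ t : {t : AdmTripleAll U // t.μ = μ}, U.omega t.1.μ t.1.hμ t.1.ε t.1.χ)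
      (i : (toThm418Data C (U.rest (restTailOne φ ι hμ hw Car (T.rhoΩOne φ ι hμ hw Car)))).AdmIndex),
      (DirectSum.lequivCongrLeft ℂ e y) i = y (e.symm i) := fun y i => DirectSum.lequivCongrLeft_apply _ _ _ _
  refine ⟨Θ.trans (DirectSum.lequivCongrLeft ℂ e), fun g x i => ?_⟩
  have h3 := congrArg ((U.rho (e.symm i).1.μ (e.symm i).1.hμ (e.symm i).1.ε (e.symm i).1.χ) g) (key (Θ x) i).symm
  exact (key _ i).trans ((hΘG g x (e.symm i)).trans h3)

end MainIso

end Summit.HodgeConjecture.CorCM.Lines.A3Liu418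

end
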